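import Summits.BirchSwinnertonDyer.BirchSwinnertonDyer.Theorems.EisensteinPrimesMazurMCOnCellBTwistbackDefectSwapDown
import Summits.BirchSwinnertonDyer.BirchSwinnertonDyer.Theorems.EisensteinPrimesMazurMCOnCellBTwistbackTwoStepChain
import HarnessLib

/-!
# Crux 3 `MazurMCOnCellB` (stmt-BirchSwinnertonDyer-19033), line `twistback` v8/v9 — ZIG-ZAGS OF TWO-STEP EDGES:
# Mazur's main conjecture at an X2b pair CONNECTED (not merely forward-reachable) to a Ш-unit class

Width seat bsd-line-x2-p1-w3 (gen 14), cell `bsd-eis`, 2026-08-28; lane F2c (sequel of F2 p669353 `…DefectSwapUp` and F2b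
p670895 `…DefectSwapDown`); `--supports stmt-BirchSwinnertonDyer-19033 --as helper`. HONEST FRAMING: conditional THEOREMS
ONLY (no `def`, no named fact introduced, no `sorry`); closes no registered stub; no summit statement, no Mazur main
conjecture and no case of BSD is proved for any curve unconditionally; 0 cells / labels / stubs / tiers move.

## What

x2-p1-w6 g3's edge `TwoStepAt p A B` (`…TwistbackTwoStepDefs`) carries `BSD(p)` BACKWARDS (`B ⟹ A`, `…TwoStepChain`, at
an X2b source `A`) and, since F2/F2b, FORWARDS (`A ⟹ B`, `…DefectSwapDown.bsdp_target_of_cellB_of_twoStepAt_of_bsdp`, at an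
X2b source `A` with `BSDp A p`). Hence `BSD(p)` — and with it Mazur's main conjecture at an X2b pair — travels along any
ZIG-ZAG of edges. The zig-zag relation is written INLINE (no `def`): one step from `A` to `B` is
`TwoStepAt p A B ∨ (TwoStepAt p B A ∧ «(B, p) is X2b»)` — a forward edge, or a backward edge whose source is asserted X2b
(forward edges transport X2b by `cellB_of_cellB_of_twoStepAt`; backward ones do not, since `TwoStepAt` does not record the
analytic rank of its source).

* `cellB_and_bsdp_imp_of_cellB_of_zigzag` — the induction: along a zig-zag out of an X2b pair `(W, p)` every node is X2b and
  `BSDp` at the node implies `BSDp W p`.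
* `bsdp_of_cellB_of_zigzag_of_bsdp` / `mazurMainConjectureAt_of_cellB_of_zigzag_of_bsdp` — `BSDp` (resp. the main
  conjecture) at `(W, p)` from `BSDp` at the far end of a zig-zag.
* `mazurMainConjectureAt_of_cellB_of_zigzag_classShaUnit` — the same from v8's Ш-UNIT CLASS DATUM at the far end (a
  globally minimal curve isogenous to the far node with `#Ш_an` a rational `p`-unit; Wuthrich 2014 Prop. 21). This is the
  statement a LEAD may negate as «no Ш-unit class CONNECTED to the class of `W`» ⊋ v9's «… REACHABLE from» (said, not
  filed; W-79).

DESK = the v8 cone's: `EisensteinPrimes.PublishedInputs` (stmt-…-19037), (2c) Mazur 1978 Cor. 4.1, (2f) Hsieh 2014 Thm. 1,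
(2g) Liu–Zhang–Zhang 2018, (2k) Wuthrich 2014 Prop. 21, Keller–Yin Thm. D (UNREFEREED PREPRINT) — STEP L (item -27489) is fed
from them by x2-p1-w3 g12's `…OfNamedFacts.heegnerIndexIdentityKRankOne_of_thmD_OPEN_of_hsieh_of_thm151_thm153` (Poitou–Tate
DISCHARGED by cell bsd-schneider's tree theorems). NOT CLAIMED: no edge is produced; nothing class-wide; stub 6‴ untouched.

References: [CastellaEtAl2021] Thm. 5.3.1, (5.5)–(5.7); [KellerYin2024] Thm. D (PRE); [Wuthrich2014] Prop. 21, Thm. 16;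
[Mazur1978] Cor. 4.1; [LiuZhangZhang2018] Thms. 1.5.1/1.5.3; [Hsieh2014] Thm. 1; [MilneADT2006] Thm. I.7.3;
[Miller2011LMS] Def. 1.1; [GreenbergLNM1716] §4.
-/

set_option autoImplicit false
-- `Summit.BirchSwinnertonDyer.BirchSwinnertonDyer.…`: the summit and its single sub-problem share a name.
set_option linter.dupNamespace false

noncomputable section

open scoped Classical MatrixGroups ModularForm

open CongruenceSubgroup WeierstrassCurve NumberField
  Literature.NumberTheory.EllipticCurves
  Literature.NumberTheory.EllipticCurves.ModularForms
  Literature.NumberTheory.QuadraticFields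
  Literature.NumberTheory.EllipticCurves.Rank1Residual
  Literature.NumberTheory.EllipticCurves.Rank1Residual.Typed
  Literature.NumberTheory.EllipticCurves.Wuthrich2014
  Literature.NumberTheory.EllipticCurves.SteinWuthrich2013
  Literature.NumberTheory.EllipticCurves.GreenbergVatsal2000
  Literature.NumberTheory.EllipticCurves.KellerYin2024
  Literature.NumberTheory.GaloisCohomology
  Summit.BirchSwinnertonDyer.Rank1Residual
  Summit.BirchSwinnertonDyer.BirchSwinnertonDyer.Theses
  Summit.BirchSwinnertonDyer.BirchSwinnertonDyer.Theorems
  Summit.BirchSwinnertonDyer.BirchSwinnertonDyer.Theorems.EisensteinPrimesMazurMCOnCellBTwistbackTwoStepDefs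
  Summit.BirchSwinnertonDyer.BirchSwinnertonDyer.Theorems.EisensteinPrimesMazurMCOnCellBTwistbackTwoStepChain
  Summit.BirchSwinnertonDyer.BirchSwinnertonDyer.Theorems.EisensteinPrimesMazurMCOnCellBTwistbackDefectSwapUp
  Summit.BirchSwinnertonDyer.BirchSwinnertonDyer.Theorems.EisensteinPrimesMazurMCOnCellBTwistbackDefectSwapDown
  Summit.BirchSwinnertonDyer.BirchSwinnertonDyer.Theorems.EisensteinPrimesMazurMCOnCellBOfNamedFacts

namespace Summit.BirchSwinnertonDyer.BirchSwinnertonDyer.Theorems.EisensteinPrimesMazurMCOnCellBTwistbackDefectSwapZigzag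

/-! ## §1. The induction along a zig-zag -/

/-- **Along a zig-zag of two-step edges out of an X2b pair, every node is X2b and `BSD(p)` flows back to the start.** The
step relation (inline): `TwoStepAt p A B ∨ (TwoStepAt p B A ∧ (B, p) is X2b)`. Induction on `Relation.ReflTransGen`:
a forward edge transports X2b (`cellB_of_cellB_of_twoStepAt`) and returns `BSDp` by x2-p1-w6 g3's backward door
(`…TwoStepChain.bsdp_of_cellB_of_reflTransGen_twoStepAt_of_bsdp` on a single edge); a backward edge carries its X2b
assertion and returns `BSDp` by the forward door `…DefectSwapDown.bsdp_target_of_cellB_of_twoStepAt_of_bsdp` (STEP L fed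
from Keller–Yin Thm. D + Hsieh + LZZ, Poitou–Tate discharged). Desk: the v8 cone without (2k). CONDITIONAL.
[claim: KellerYin2024, status: under-review] [cite: KellerYin2024, Thm. D = Thm. 5.1.3 (arXiv:2402.12781v2 L306–L309)]
[cite: CastellaEtAl2021, Thm. 5.3.1 and (5.5)–(5.7)] [cite: Mazur1978, Cor. 4.1] [cite: MilneADT2006, Thm. I.7.3] -/
theorem cellB_and_bsdp_imp_of_cellB_of_zigzag (hP : EisensteinPrimes.PublishedInputs)
    (hMaz : mazur_not_dvd_maninConstant_of_odd) (hH : hsieh2014_exists_anticyclotomicPAdicLFunction)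
    (hF : LiuZhangZhang2018.thm151_thm153_modularCurve_heegnerVector)
    (hD : KellerYin2024.thmD_imcMult_exists_isBDPLFunction_isTorsion_charIdeal_eq_OPEN)
    {p : ℕ} [Fact p.Prime] {W : WeierstrassCurve ℚ} [W.IsElliptic] [W.IsGloballyMinimal] (hc : X2.CellB W p)
    {U : WeierstrassCurve ℚ}
    (h : Relation.ReflTransGen (fun A B : WeierstrassCurve ℚ ↦ TwoStepAt p A B ∨
      (TwoStepAt p B A ∧ ∃ (_ : B.IsElliptic) (_ : B.IsGloballyMinimal), X2.CellB B p)) W U) :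
    ∃ (_ : U.IsElliptic) (_ : U.IsGloballyMinimal), X2.CellB U p ∧ (BSDp U p → BSDp W p) := by
  have hnf := hP.2.2.2.2.2.1
  have hE : WeierstrassCurve.hasEntireLFunction_rat :=
    WeierstrassCurve.hasEntireLFunction_rat_of_exists_isNewformOf hnf
  have hPT : ∀ (K : Type) [Field K] [NumberField K], poitouTate_selmerStructure_duality K :=
    fun K _ _ ↦ SchneiderFreeAdditiveX3.PoitouTateReduction.poitouTate_selmerStructure_duality_holds K
  have hPT2 : ∀ (K : Type) [Field K] [NumberField K], poitouTate_sha_tateDual K :=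
    fun K _ _ ↦ SchneiderFreeAdditiveX3.PoitouTateReduction.poitouTate_sha_tateDual_holds K
  have hSL : EisensteinPrimes.HeegnerIndexIdentityKRankOne :=
    heegnerIndexIdentityKRankOne_of_thmD_OPEN_of_hsieh_of_thm151_thm153 hP hH hF hD
  induction h with
  | refl => exact ⟨inferInstance, inferInstance, hc, id⟩
  | tail _ hstep ih =>
    obtain ⟨hE₁, hM₁, hc₁, himp⟩ := ih
    rcases hstep with hfwd | ⟨hbwd, hE₂, hM₂, hc₂⟩
    · -- forward edge: X2b transported, `BSDp` returns by the backward door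
      obtain ⟨_, _, hE₂, hM₂, -⟩ := id hfwd
      exact ⟨hE₂, hM₂, cellB_of_cellB_of_twoStepAt hE hc₁ hfwd, fun hB₂ ↦ himp
        (bsdp_of_cellB_of_reflTransGen_twoStepAt_of_bsdp hP hPT hPT2 hH hF hMaz hD hc₁
          (Relation.ReflTransGen.single hfwd) hB₂)⟩
    · -- backward edge with an X2b source: `BSDp` returns by the forward door (F2 ∘ F2b)
      exact ⟨hE₂, hM₂, hc₂, fun hB₂ ↦ himp
        (bsdp_target_of_cellB_of_twoStepAt_of_bsdp hP hMaz hSL hc₂ hB₂ hbwd)⟩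

/-! ## §2. `BSD(p)` and the main conjecture at an X2b pair connected to a closed pair / to a Ш-unit class -/

/-- **`BSD(E,p)` at an X2b pair CONNECTED by a zig-zag of two-step edges to a pair with `BSD(p)`.** Same desk as §1.
CONDITIONAL. [claim: KellerYin2024, status: under-review] [cite: KellerYin2024, Thm. D = Thm. 5.1.3]
[cite: CastellaEtAl2021, Thm. 5.3.1 and (5.5)–(5.7)] [cite: MilneADT2006, Thm. I.7.3] [cite: Miller2011LMS, Def. 1.1] -/
theorem bsdp_of_cellB_of_zigzag_of_bsdp (hP : EisensteinPrimes.PublishedInputs)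
    (hMaz : mazur_not_dvd_maninConstant_of_odd) (hH : hsieh2014_exists_anticyclotomicPAdicLFunction)
    (hF : LiuZhangZhang2018.thm151_thm153_modularCurve_heegnerVector)
    (hD : KellerYin2024.thmD_imcMult_exists_isBDPLFunction_isTorsion_charIdeal_eq_OPEN)
    {p : ℕ} [Fact p.Prime] {W U : WeierstrassCurve ℚ} [W.IsElliptic] [W.IsGloballyMinimal]
    [U.IsElliptic] [U.IsGloballyMinimal] (hc : X2.CellB W p)
    (h : Relation.ReflTransGen (fun A B : WeierstrassCurve ℚ ↦ TwoStepAt p A B ∨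
      (TwoStepAt p B A ∧ ∃ (_ : B.IsElliptic) (_ : B.IsGloballyMinimal), X2.CellB B p)) W U)
    (hU : BSDp U p) : BSDp W p := by
  obtain ⟨_, _, -, himp⟩ := cellB_and_bsdp_imp_of_cellB_of_zigzag hP hMaz hH hF hD hc h
  exact himp hU

/-- **Mazur's main conjecture at an X2b pair CONNECTED by a zig-zag to a pair with `BSD(p)`** — `bsdp_of_cellB_of_zigzag_of_bsdp`
and the exact converse at an odd multiplicative reducible rank-`0` pair (`X2.mazurMainConjectureAt_of_bsdp_of_red`; Wuthrich
Thm. 16, Stein–Wuthrich, Greenberg–Stevens from `PublishedInputs`). CONDITIONAL; a main conjecture is proved for no curve.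
[claim: KellerYin2024, status: under-review] [cite: Wuthrich2014, Thm. 16 and §5 (p. 397)]
[cite: GreenbergLNM1716, §4 (PDF pp. 112–113)] [cite: Miller2011LMS, Def. 1.1] -/
theorem mazurMainConjectureAt_of_cellB_of_zigzag_of_bsdp (hP : EisensteinPrimes.PublishedInputs)
    (hMaz : mazur_not_dvd_maninConstant_of_odd) (hH : hsieh2014_exists_anticyclotomicPAdicLFunction)
    (hF : LiuZhangZhang2018.thm151_thm153_modularCurve_heegnerVector)
    (hD : KellerYin2024.thmD_imcMult_exists_isBDPLFunction_isTorsion_charIdeal_eq_OPEN)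
    {p : ℕ} [Fact p.Prime] {W U : WeierstrassCurve ℚ} [W.IsElliptic] [W.IsGloballyMinimal]
    [U.IsElliptic] [U.IsGloballyMinimal] (hc : X2.CellB W p)
    (h : Relation.ReflTransGen (fun A B : WeierstrassCurve ℚ ↦ TwoStepAt p A B ∨
      (TwoStepAt p B A ∧ ∃ (_ : B.IsElliptic) (_ : B.IsGloballyMinimal), X2.CellB B p)) W U)
    (hU : BSDp U p) : X2.MazurMainConjectureAt W p := by
  have hnf := hP.2.2.2.2.2.1
  have hGZK := hP.2.2.2.2.2.2.2.2.2.2.1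
  have hWu := hP.2.2.2.2.2.2.2.2.2.2.2.2.2.2.1
  have hJs := hP.2.2.2.2.2.2.2.2.2.2.2.2.2.2.2.1
  have hJn := hP.2.2.2.2.2.2.2.2.2.2.2.2.2.2.2.2.1
  have hHs := hP.2.2.2.2.2.2.2.2.2.2.2.2.2.2.2.2.2.1
  have hHn := hP.2.2.2.2.2.2.2.2.2.2.2.2.2.2.2.2.2.2.1
  have hGS := hP.2.2.2.2.2.2.2.2.2.2.2.2.2.2.2.2.2.2.2
  have hE : WeierstrassCurve.hasEntireLFunction_rat :=
    WeierstrassCurve.hasEntireLFunction_rat_of_exists_isNewformOf hnf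
  exact X2.mazurMainConjectureAt_of_bsdp_of_red hWu hJs hJn hHs hHn hGZK hE W p (hGS W p) hc.2.1.1 hc.2.1.2.2
    hc.2.1.2.1 hc.1 (bsdp_of_cellB_of_zigzag_of_bsdp hP hMaz hH hF hD hc h hU)

/-- **Mazur's main conjecture at an X2b pair CONNECTED by a zig-zag to a Ш-UNIT CLASS** (v8's class datum VERBATIM at the
far node `U`: a globally minimal `U' ∼ U` with `#Ш_an(U')` a rational `p`-unit): `(U, p)` is X2b (§1), so Wuthrich Prop. 21
+ Cassels close `BSDp U p` (`…DefectSwapUp.bsdp_of_cellB_of_classShaUnit`), and §2 applies. Desk = the v8 cone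
{`PublishedInputs`, (2c), (2f), (2g), (2k), Keller–Yin Thm. D}. The negation «no Ш-unit class CONNECTED to the class of
`W`» is what would remain to a registered stub on this road; it is WEAKER than v9's «… REACHABLE from» (said for the LEAD,
not filed). CONDITIONAL; a main conjecture is proved for no curve. [claim: KellerYin2024, status: under-review]
[cite: Wuthrich2014, Prop. 21 (p. 400) and Thm. 16 (p. 397)] [cite: KellerYin2024, Thm. D = Thm. 5.1.3]
[cite: MilneADT2006, Thm. I.7.3 (Cassels)] [cite: Miller2011LMS, Def. 1.1] -/
theorem mazurMainConjectureAt_of_cellB_of_zigzag_classShaUnit (hP : EisensteinPrimes.PublishedInputs)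
    (hW21 : sha_dvd_analyticSha) (hMaz : mazur_not_dvd_maninConstant_of_odd)
    (hH : hsieh2014_exists_anticyclotomicPAdicLFunction)
    (hF : LiuZhangZhang2018.thm151_thm153_modularCurve_heegnerVector)
    (hD : KellerYin2024.thmD_imcMult_exists_isBDPLFunction_isTorsion_charIdeal_eq_OPEN)
    {p : ℕ} [Fact p.Prime] {W U : WeierstrassCurve ℚ} [W.IsElliptic] [W.IsGloballyMinimal]
    [U.IsElliptic] [U.IsGloballyMinimal] (hc : X2.CellB W p)
    (h : Relation.ReflTransGen (fun A B : WeierstrassCurve ℚ ↦ TwoStepAt p A B ∨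
      (TwoStepAt p B A ∧ ∃ (_ : B.IsElliptic) (_ : B.IsGloballyMinimal), X2.CellB B p)) W U)
    (h0 : ∃ (U' : WeierstrassCurve ℚ) (_ : U'.IsElliptic) (_ : U'.IsGloballyMinimal),
      IsIsogenous U U' ∧ ∃ q : ℚ, shaAn U' = (q : ℂ) ∧ padicValRat p q = 0) :
    X2.MazurMainConjectureAt W p := by
  obtain ⟨_, _, hcU, -⟩ := cellB_and_bsdp_imp_of_cellB_of_zigzag hP hMaz hH hF hD hc h
  exact mazurMainConjectureAt_of_cellB_of_zigzag_of_bsdp hP hMaz hH hF hD hc h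
    (bsdp_of_cellB_of_classShaUnit hP hW21 U p hcU h0)

/-- **v9's shape, isogeny at BOTH ends, with «reachable» widened to «connected»**: at an X2b pair `(W, p)`, a globally
minimal `W₁ ∼ W`, a zig-zag of two-step edges from `W₁` to `U`, and a globally minimal `Uc ∼ U` with `#Ш_an(Uc)` a rational
`p`-unit give Mazur's main conjecture at `(W, p)`: X2b passes to `W₁` (`X2.cellB_iff_of_isIsogenous`, Tate facts
discharged), §1–§2 give `BSDp W₁ p`, Cassels carries it to `W` (`X2.bsdp_of_isIsogenous_of_bsdp`), and the exact converse
closes (`X2.mazurMainConjectureAt_of_bsdp_of_red`). VERBATIM the binder shape of LEAD g14's v9 datum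
(`stub_upperPartnerOffSubrowNoReachableClassShaUnit`) with `Relation.ReflTransGen (TwoStepAt p)` replaced by the zig-zag
relation (which contains it: `zigzag_of_reflTransGen_twoStepAt`). Desk = the v8/v9 cone. CONDITIONAL; a main conjecture is
proved for no curve. [claim: KellerYin2024, status: under-review] [cite: Wuthrich2014, Prop. 21 (p. 400) and Thm. 16 (p. 397)]
[cite: KellerYin2024, Thm. D = Thm. 5.1.3] [cite: MilneADT2006, Thm. I.7.3 (Cassels)] [cite: Miller2011LMS, Def. 1.1] -/
theorem mazurMainConjectureAt_of_cellB_of_connectedClassShaUnit (hP : EisensteinPrimes.PublishedInputs)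
    (hW21 : sha_dvd_analyticSha) (hMaz : mazur_not_dvd_maninConstant_of_odd)
    (hH : hsieh2014_exists_anticyclotomicPAdicLFunction)
    (hF : LiuZhangZhang2018.thm151_thm153_modularCurve_heegnerVector)
    (hD : KellerYin2024.thmD_imcMult_exists_isBDPLFunction_isTorsion_charIdeal_eq_OPEN)
    (W : WeierstrassCurve ℚ) [W.IsElliptic] [W.IsGloballyMinimal] (p : ℕ) [Fact p.Prime] (hc : X2.CellB W p)
    (h0 : ∃ (W₁ U Uc : WeierstrassCurve ℚ) (_ : W₁.IsElliptic) (_ : W₁.IsGloballyMinimal) (_ : U.IsElliptic)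
      (_ : U.IsGloballyMinimal) (_ : Uc.IsElliptic) (_ : Uc.IsGloballyMinimal),
      IsIsogenous W W₁ ∧
      Relation.ReflTransGen (fun A B : WeierstrassCurve ℚ ↦ TwoStepAt p A B ∨
        (TwoStepAt p B A ∧ ∃ (_ : B.IsElliptic) (_ : B.IsGloballyMinimal), X2.CellB B p)) W₁ U ∧
      IsIsogenous U Uc ∧ ∃ q : ℚ, shaAn Uc = (q : ℂ) ∧ padicValRat p q = 0) :
    X2.MazurMainConjectureAt W p := by
  have hCassels := hP.2.1
  have hnf := hP.2.2.2.2.2.1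
  have hGZK := hP.2.2.2.2.2.2.2.2.2.2.1
  have hWu := hP.2.2.2.2.2.2.2.2.2.2.2.2.2.2.1
  have hJs := hP.2.2.2.2.2.2.2.2.2.2.2.2.2.2.2.1
  have hJn := hP.2.2.2.2.2.2.2.2.2.2.2.2.2.2.2.2.1
  have hHs := hP.2.2.2.2.2.2.2.2.2.2.2.2.2.2.2.2.2.1
  have hHn := hP.2.2.2.2.2.2.2.2.2.2.2.2.2.2.2.2.2.2.1
  have hGS := hP.2.2.2.2.2.2.2.2.2.2.2.2.2.2.2.2.2.2.2
  have hE : WeierstrassCurve.hasEntireLFunction_rat :=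
    WeierstrassCurve.hasEntireLFunction_rat_of_exists_isNewformOf hnf
  obtain ⟨W₁, U, Uc, _, _, _, _, _, _, hiso, hz, hisoU, hunit⟩ := h0
  have hc₁ : X2.CellB W₁ p :=
    (X2.cellB_iff_of_isIsogenous (p := p) TateCurve.Silverman1994_thmV53_tateUniformisation_holds
      TateCurve.Silverman1994_thmV53_corV54_tateUniformisation_holds hiso).mp hc
  obtain ⟨_, _, hcU, himp⟩ := cellB_and_bsdp_imp_of_cellB_of_zigzag hP hMaz hH hF hD hc₁ hz
  have hBU : BSDp U p := bsdp_of_cellB_of_classShaUnit hP hW21 U p hcU ⟨Uc, inferInstance, inferInstance, hisoU, hunit⟩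
  have hB₁ : BSDp W₁ p := himp hBU
  have hB : BSDp W p :=
    X2.bsdp_of_isIsogenous_of_bsdp hCassels hGZK hE W₁ W hiso.symm_of_charZero p (by rw [hc₁.1]; omega) hB₁
  exact X2.mazurMainConjectureAt_of_bsdp_of_red hWu hJs hJn hHs hHn hGZK hE W p (hGS W p) hc.2.1.1 hc.2.1.2.2
    hc.2.1.2.1 hc.1 hB

/-- **The forward chains of v9 are zig-zags** (every `Relation.ReflTransGen (TwoStepAt p)` chain is a chain of the inline
zig-zag relation, one `Or.inl` per edge), so the «CONNECTED» statements above contain the «REACHABLE» ones of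
x2-p1-w6 g3's `…TwoStepChain`. Bookkeeping. [folklore] -/
theorem zigzag_of_reflTransGen_twoStepAt {p : ℕ} [Fact p.Prime] {W U : WeierstrassCurve ℚ}
    (h : Relation.ReflTransGen (TwoStepAt p) W U) :
    Relation.ReflTransGen (fun A B : WeierstrassCurve ℚ ↦ TwoStepAt p A B ∨
      (TwoStepAt p B A ∧ ∃ (_ : B.IsElliptic) (_ : B.IsGloballyMinimal), X2.CellB B p)) W U := by
  induction h with
  | refl => exact Relation.ReflTransGen.refl
  | tail _ hbc ih => exact ih.tail (Or.inl hbc)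

/-- **… and so are the REVERSED chains out of a closed X2b pair**: if `(U, p)` is X2b and `Relation.ReflTransGen (TwoStepAt p) U W`
(a forward chain from `U` INTO `W`), then `W` is connected to `U` by a zig-zag (each reversed edge carries the X2b assertion
of its source, transported from `U` by `cellB_of_cellB_of_reflTransGen_twoStepAt`). With
`mazurMainConjectureAt_of_cellB_of_zigzag_classShaUnit`: an X2b pair DOWNSTREAM of a Ш-unit class satisfies the main
conjecture (modulo the desk). Bookkeeping + composition. [folklore] -/
theorem zigzag_of_reflTransGen_twoStepAt_reverse (hmod : WeierstrassCurve.hasEntireLFunction_rat)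
    {p : ℕ} [Fact p.Prime] {U W : WeierstrassCurve ℚ} [U.IsElliptic] [U.IsGloballyMinimal]
    (hcU : X2.CellB U p) (h : Relation.ReflTransGen (TwoStepAt p) U W) :
    Relation.ReflTransGen (fun A B : WeierstrassCurve ℚ ↦ TwoStepAt p A B ∨
      (TwoStepAt p B A ∧ ∃ (_ : B.IsElliptic) (_ : B.IsGloballyMinimal), X2.CellB B p)) W U := by
  induction h with
  | refl => exact Relation.ReflTransGen.refl
  | @tail V W' hUV hVW ih =>
    -- `U →* V → W'`: the reversed edge `W' ← V` carries `CellB V`, transported from `U`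
    obtain ⟨hEV, hMV, _, _, -⟩ := id hVW
    have hcV : X2.CellB V p := cellB_of_cellB_of_reflTransGen_twoStepAt hmod hcU hUV
    exact Relation.ReflTransGen.head (Or.inr ⟨hVW, hEV, hMV, hcV⟩) ih

end Summit.BirchSwinnertonDyer.BirchSwinnertonDyer.Theorems.EisensteinPrimesMazurMCOnCellBTwistbackDefectSwapZigzag

end
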